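import Literature.Analysis.FluidPDE.TypeIAncientMild
import Literature.Analysis.FluidPDE.CZeroSolenoidalPeriodOperators
import Literature.Analysis.FluidPDE.SolenoidalCZeroTestFields
import Literature.Analysis.FluidPDE.RdssPeriodConcatenation
import Mathlib.Analysis.Calculus.FDeriv.Comp
import HarnessLib

/-!
# Route `FilamentSkeletonRss`, crux `RdssProfileTruncation` (stmt-NavierStokesRegularity-11289),
  line `Sketch` — stub `stub_rdssPeriodPackage` (the period-map package and its semantics)

Given the one-period perturbation flow `Φ` of a rotated discretely self-similar Type-I ancient
mild solution `u` (factor `c > 1`, isometry `R`; the hypothesis package of `stub_rdssSlabFlow`),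
we build the functional-analytic package consumed by the abstract steering theorem and read off
the physical meaning of a trapped orbit:

* the Banach space `E = C₀,σ` (continuous, weakly divergence-free fields vanishing at infinity,
  sup norm), realised as a closed submodule of `lp (fun _ : ℝ³ => ℝ³) ⊤`
  (`exists_isClosed_submodule_czero_solenoidal`), with `ι` the underlying-field map;
* the zoom-out `𝒮⁻¹g = c⁻¹ R g(c⁻¹R⁻¹·)` (norm `≤ c⁻¹`), the heat operator `e^{(1−c⁻²)Δ}`
  (norm `≤ 1`) and the linear part `Klin` (COMPACT: uniform tails + equicontinuity,
  Arzelà–Ascoli) as bounded operators (`exists_zoom_clm`, `exists_heat_clm`,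
  `exists_compact_clm_of_pointwise`); the final-slice map `P g = Φ g (−c⁻²)` with strict
  derivative `H + Klin` at `0` (`exists_selfMap_hasStrictFDerivAt_zero`); the period map
  `T = 𝒮⁻¹ ∘ P`, `M = DT(0) = S + K`, `S = 𝒮⁻¹ ∘ e^{(1−c⁻²)Δ}` with `‖Sⁿ‖ ≤ c⁻ⁿ`,
  `K = 𝒮⁻¹ ∘ Klin` compact;
* the dense submodule `D` of smooth compactly supported divergence-free elements and the small
  solenoidal truncation data `Ψ_L(u(−1)) − u(−1)` (`SolenoidalCZeroTestFields`);
* the semantics: along an orbit `g_k = Tᵏg` in the `η₀`-ball the model solutions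
  `u + Φ g_k` on `[−1, −c⁻²]` satisfy the junction condition
  `(u + Φ g_{k+1})(−1) = 𝒮⁻¹((u + Φ g_k)(−c⁻²))` (rotated self-similarity of `u` and the
  definition of `T`), so they concatenate (`exists_concatenation_of_periodic_slabs`) to an
  Oseen-mild solution on `[0, 1)` from `u(−1) + g`, bounded on every `[0, 1 − δ]` and
  unbounded at `(1, 0)` since `‖(u + Φ g_k)(−1, y₀)‖ ≥ ‖u(−1, y₀)‖ − η₀ ≥ ‖u(−1, y₀)‖/2`.
-/

noncomputable section

open MeasureTheory Set Filter Topology Function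
open scoped RealInnerProductSpace ContDiff

set_option linter.dupNamespace false

namespace Summit.NavierStokesRegularity.NavierStokesRegularity.Theorems

open Literature.Analysis Literature.Analysis.FluidPDE

/-- Physical space `ℝ³`. -/
local notation "ℝ³" => EuclideanSpace ℝ (Fin 3)

/-- Powers of a bounded operator of norm `≤ θ` have norm `≤ 1 · θⁿ` (submultiplicativity;
`‖S⁰‖ = ‖1‖ ≤ 1`). [folklore] -/
theorem norm_pow_le_one_mul_pow {X : Type*} [NormedAddCommGroup X] [NormedSpace ℝ X]
    (S : X →L[ℝ] X) {θ : ℝ} (h : ‖S‖ ≤ θ) (n : ℕ) : ‖S ^ n‖ ≤ 1 * θ ^ n := by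
  rw [one_mul]
  cases n with
  | zero =>
      rw [pow_zero, pow_zero, ContinuousLinearMap.one_def]
      exact ContinuousLinearMap.norm_id_le
  | succ n =>
      exact (norm_pow_le' S (Nat.succ_pos n)).trans (pow_le_pow_left₀ (norm_nonneg _) h _)

/-- **Rotated self-similarity read at the slice `t = −1`**: `u(−1) = 𝒮⁻¹(u(−c⁻²))`, i.e.
`u(−1, y) = c⁻¹ R u(−c⁻², c⁻¹R⁻¹y)` (Chae–Wolf 2017, Def. 1.1, at `t = −c⁻²`). [cite: ChaeWolf2017, Def. 1.1] -/
theorem rdss_slice_neg_one {c : ℝ} (hc : 0 < c) {R : ℝ³ ≃ₗᵢ[ℝ] ℝ³} {u : ℝ → ℝ³ → ℝ³}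
    (h : IsRotatedDSS c R u) (y : ℝ³) :
    u (-1) y = c⁻¹ • R (u (-(c ^ 2)⁻¹) (c⁻¹ • R.symm y)) := by
  have key := h (-(c ^ 2)⁻¹) (c⁻¹ • R.symm y)
  have e1 : c ^ 2 * -(c ^ 2)⁻¹ = -1 := by
    rw [mul_neg, mul_inv_cancel₀ (pow_ne_zero 2 hc.ne')]
  have e2 : c • R (c⁻¹ • R.symm y) = y := by
    rw [LinearIsometryEquiv.map_smul, smul_smul, mul_inv_cancel₀ hc.ne', one_smul,
      LinearIsometryEquiv.apply_symm_apply]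
  rw [e1, e2] at key
  rw [← key, LinearIsometryEquiv.map_smul, smul_smul, inv_mul_cancel₀ hc.ne', one_smul,
    LinearIsometryEquiv.apply_symm_apply]

/-- **stub_rdssPeriodPackage** (functional-analytic packaging of the period map and the physical
semantics of a trapped orbit).  GIVEN the one-period flow package of `stub_rdssSlabFlow` (as a
hypothesis), build: the Banach space `E` (continuous weakly divergence-free fields vanishing at
infinity, sup norm; a closed submodule of `lp (fun _ : ℝ³ => ℝ³) ⊤`), the dense submodule `D`
of smooth compactly supported divergence-free fields (sup-density by mollification and the
solenoidal truncation), the zoom-out `𝒮⁻¹ g = c⁻¹ R g(c⁻¹ R⁻¹ ·)` as an operator of norm `c⁻¹`,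
the recentred period map `T g = 𝒮⁻¹ (Φ g (−c⁻²))` (junk `0` off the `δ₀`-ball; `T 0 = 0`), its
strict derivative `M = S + K`, `S = 𝒮⁻¹ ∘ e^{(1−c⁻²)Δ}` (`‖Sⁿ‖ ≤ c⁻ⁿ`), `K = 𝒮⁻¹ ∘ Klin` compact
(finite sup-norm nets ⇒ totally bounded image of the unit ball), the truncation data
`e_L = Ψ_L(u(−1)) − u(−1)` (sup norm `O(C₀/L)`), and the SEMANTICS: for an orbit `g_k = Tᵏ g` in
the `η₀`-ball (`η₀ = min(δ₀/2, |u(−1) y₀|/2)`), the concatenation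
`v(t) = 𝒮^k[(u + Φ g_k)(c^{2k} ·)]` on the slabs `[−c^{−2k}, −c^{−2k−2}]`, shifted by `+1` in
time, is continuous (junctions match because `T g_k = 𝒮⁻¹(Φ g_k(−c⁻²))` and `u` is rotated DSS),
weakly divergence free, bounded on every `[0, 1−δ]`, solves the Oseen equation between all pairs
(zoom covariance of the heat and Oseen kernels, gluing across slabs), and is unbounded at
`(1, 0)`: `‖v(1 − c^{−2k}, c^{−k} (R⁻¹)^k y₀)‖ = cᵏ ‖u(−1) y₀ + g_k y₀‖ ≥ cᵏ |u(−1) y₀|/2`.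
[cite: BradshawTsai2017CPDE, §1 (RDSS, period map modulo rotation); KochNadirashviliSereginSverak2009, §4] -/
theorem stub_rdssPeriodPackage :
    ∀ (C C₀ c : ℝ) (R : ℝ³ ≃ₗᵢ[ℝ] ℝ³) (u : ℝ → ℝ³ → ℝ³) (y₀ : ℝ³),
      IsTypeIAncientMild C u → IsRotatedDSS c R u → 1 < c → HasTypeIDecay C₀ u → u (-1) y₀ ≠ 0 →
      (∃ δ₀ : ℝ, 0 < δ₀ ∧ ∃ Λ : ℝ, 0 ≤ Λ ∧
        ∃ (Φ : (ℝ³ → ℝ³) → ℝ → ℝ³ → ℝ³) (Klin : (ℝ³ → ℝ³) → ℝ³ → ℝ³),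
        (∀ t x, Φ 0 t x = 0) ∧
        (∀ g : ℝ³ → ℝ³, Continuous g → Tendsto g (cocompact ℝ³) (𝓝 0) → IsWeaklyDivFree g →
          ∀ B : ℝ, (∀ x, ‖g x‖ ≤ B) → B < δ₀ →
            Φ g (-1) = g ∧
            ContinuousOn (uncurry (Φ g)) (Icc (-1) (-(c ^ 2)⁻¹) ×ˢ univ) ∧
            (∀ t ∈ Icc (-1 : ℝ) (-(c ^ 2)⁻¹), Tendsto (Φ g t) (cocompact ℝ³) (𝓝 0) ∧
              IsWeaklyDivFree (Φ g t) ∧ ∀ x, ‖Φ g t x‖ ≤ Λ * B) ∧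
            (∀ s t : ℝ, -1 ≤ s → s < t → t ≤ -(c ^ 2)⁻¹ → ∀ x,
              (u + Φ g) t x = heatFlow ((u + Φ g) s) (t - s) x -
                oseenDuhamel 1 s (u + Φ g) (u + Φ g) t x)) ∧
        (∀ g₁ g₂ : ℝ³ → ℝ³, Continuous g₁ → Tendsto g₁ (cocompact ℝ³) (𝓝 0) → IsWeaklyDivFree g₁ →
          Continuous g₂ → Tendsto g₂ (cocompact ℝ³) (𝓝 0) → IsWeaklyDivFree g₂ →
          ∀ B Bd : ℝ, (∀ x, ‖g₁ x‖ ≤ B) → (∀ x, ‖g₂ x‖ ≤ B) → B < δ₀ → (∀ x, ‖g₁ x - g₂ x‖ ≤ Bd) →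
            ∀ t ∈ Icc (-1 : ℝ) (-(c ^ 2)⁻¹), ∀ x, ‖Φ g₁ t x - Φ g₂ t x‖ ≤ Λ * Bd) ∧
        (∀ h₁ h₂ : ℝ³ → ℝ³, Continuous h₁ → Tendsto h₁ (cocompact ℝ³) (𝓝 0) → IsWeaklyDivFree h₁ →
          Continuous h₂ → Tendsto h₂ (cocompact ℝ³) (𝓝 0) → IsWeaklyDivFree h₂ → ∀ r : ℝ,
            Klin (h₁ + h₂) = Klin h₁ + Klin h₂ ∧ Klin (r • h₁) = r • Klin h₁) ∧
        (∀ h : ℝ³ → ℝ³, Continuous h → Tendsto h (cocompact ℝ³) (𝓝 0) → IsWeaklyDivFree h →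
          ∀ B : ℝ, (∀ x, ‖h x‖ ≤ B) →
            Continuous (Klin h) ∧ Tendsto (Klin h) (cocompact ℝ³) (𝓝 0) ∧ IsWeaklyDivFree (Klin h) ∧
              ∀ x, ‖Klin h x‖ ≤ Λ * B) ∧
        (∀ ε : ℝ, 0 < ε → ∃ A : ℝ, ∀ h : ℝ³ → ℝ³, Continuous h → Tendsto h (cocompact ℝ³) (𝓝 0) →
          IsWeaklyDivFree h → (∀ x, ‖h x‖ ≤ 1) → ∀ x, A ≤ ‖x‖ → ‖Klin h x‖ ≤ ε) ∧
        (∀ ε : ℝ, 0 < ε → ∃ δ : ℝ, 0 < δ ∧ ∀ h : ℝ³ → ℝ³, Continuous h → Tendsto h (cocompact ℝ³) (𝓝 0) →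
          IsWeaklyDivFree h → (∀ x, ‖h x‖ ≤ 1) → ∀ x y, dist x y < δ → ‖Klin h x - Klin h y‖ ≤ ε) ∧
        (∀ ε : ℝ, 0 < ε → ∃ δ : ℝ, 0 < δ ∧ ∀ g₁ g₂ : ℝ³ → ℝ³,
          Continuous g₁ → Tendsto g₁ (cocompact ℝ³) (𝓝 0) → IsWeaklyDivFree g₁ →
          Continuous g₂ → Tendsto g₂ (cocompact ℝ³) (𝓝 0) → IsWeaklyDivFree g₂ →
          ∀ B Bd : ℝ, (∀ x, ‖g₁ x‖ ≤ B) → (∀ x, ‖g₂ x‖ ≤ B) → B < δ → (∀ x, ‖g₁ x - g₂ x‖ ≤ Bd) →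
            ∀ x, ‖(Φ g₁ (-(c ^ 2)⁻¹) x - Φ g₂ (-(c ^ 2)⁻¹) x) -
              (heatFlow (g₁ - g₂) (1 - (c ^ 2)⁻¹) x + Klin (g₁ - g₂) x)‖ ≤ ε * Bd)) →
      ∃ (E : Type) (_ : NormedAddCommGroup E) (_ : NormedSpace ℝ E) (_ : CompleteSpace E)
        (ι : E →ₗ[ℝ] (ℝ³ → ℝ³)) (D : Submodule ℝ E) (T : E → E) (M S K : E →L[ℝ] E),
        Dense (D : Set E) ∧
        (∀ d ∈ D, ContDiff ℝ ∞ (ι d) ∧ HasCompactSupport (ι d) ∧ VectorCalculus.IsDivFree (ι d)) ∧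
        M = S + K ∧ IsCompactOperator K ∧
        (∃ Cs θ₀ : ℝ, 0 ≤ θ₀ ∧ θ₀ < 1 ∧ ∀ n : ℕ, ‖S ^ n‖ ≤ Cs * θ₀ ^ n) ∧
        T 0 = 0 ∧ HasStrictFDerivAt T M 0 ∧
        (∀ ε : ℝ, 0 < ε → ∃ e : E, ‖e‖ < ε ∧ ContDiff ℝ ∞ (u (-1) + ι e) ∧
          HasCompactSupport (u (-1) + ι e) ∧ VectorCalculus.IsDivFree (u (-1) + ι e)) ∧
        ∃ η₀ : ℝ, 0 < η₀ ∧ ∀ g : E, (∀ k : ℕ, ‖T^[k] g‖ < η₀) →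
          ∃ v : ℝ → ℝ³ → ℝ³, v 0 = u (-1) + ι g ∧
            ContinuousOn (uncurry v) (Ico 0 1 ×ˢ univ) ∧
            (∀ t ∈ Ico (0 : ℝ) 1, IsWeaklyDivFree (v t)) ∧
            (∀ s t : ℝ, 0 ≤ s → s < t → t < 1 → ∀ x,
              v t x = heatFlow (v s) (t - s) x - oseenDuhamel 1 s v v t x) ∧
            (∀ δ : ℝ, 0 < δ → IsBoundedOn (Icc 0 (1 - δ)) v) ∧
            (∀ K δ : ℝ, 0 < δ → ∃ t ∈ Ico (0 : ℝ) 1, ∃ x : ℝ³, 1 - δ < t ∧ ‖x‖ < δ ∧ K < ‖v t x‖) := by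
  intro C C₀ c R u y₀ hK hrdss hc hdec hy₀ hpkg
  obtain ⟨δ₀, hδ₀, Λ, hΛ, Φ, Klin, hΦ0, hsol, -, hKlin_lin, hKlin_map, hKlin_tail, hKlin_equi,
    hder⟩ := hpkg
  -- constants
  have hc0 : 0 < c := one_pos.trans hc
  have hc2 : 0 < c ^ 2 := by positivity
  have hq0 : 0 < (c ^ 2)⁻¹ := inv_pos.2 hc2
  have hq1 : (c ^ 2)⁻¹ < 1 := inv_lt_one_of_one_lt₀ (by nlinarith)
  have hτ : 0 < 1 - (c ^ 2)⁻¹ := sub_pos.2 hq1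
  have hqneg : -(c ^ 2)⁻¹ < 0 := neg_neg_of_pos hq0
  have hE3 : Module.finrank ℝ ℝ³ = 3 := finrank_euclideanSpace_fin
  have hCnn : 0 ≤ C := hK.nonneg
  -- the Banach space `F = C₀,σ`
  obtain ⟨F, hFc, hF⟩ := exists_isClosed_submodule_czero_solenoidal (E := ℝ³)
  haveI : CompleteSpace F := hFc.completeSpace_coe
  have hPf : ∀ f : F, Continuous ⇑f.1 ∧ Tendsto ⇑f.1 (cocompact ℝ³) (𝓝 0) ∧
      IsWeaklyDivFree ⇑f.1 := fun f => (hF f.1).1 f.2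
  have hbd : ∀ f : F, ∀ x, ‖f.1 x‖ ≤ ‖f‖ := fun f =>
    FunctionSpaces.norm_apply_le_norm_submodule F f
  let ι : F →ₗ[ℝ] (ℝ³ → ℝ³) :=
    { toFun := fun f => ⇑f.1
      map_add' := fun f g => by funext x; simp
      map_smul' := fun r f => by funext x; simp }
  -- the bounded operators: zoom-out, heat, compact linear part
  obtain ⟨Z, hZ, hZn⟩ := exists_zoom_clm F hF (inv_pos.2 hc0) R
  obtain ⟨H, hH, hHn⟩ := exists_heat_clm F hF hτ
  obtain ⟨KE, hKE, -, hKEc⟩ :=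
    exists_compact_clm_of_pointwise F hFc hF Klin hΛ hKlin_lin hKlin_map hKlin_tail hKlin_equi
  -- the final slice of the slab flow as a self-map with strict derivative `H + KE`
  have hmemI : (-(c ^ 2)⁻¹ : ℝ) ∈ Icc (-1 : ℝ) (-(c ^ 2)⁻¹) := ⟨by linarith, le_rfl⟩
  have hsol1 : ∀ g : ℝ³ → ℝ³, Continuous g → Tendsto g (cocompact ℝ³) (𝓝 0) →
      IsWeaklyDivFree g → ∀ B : ℝ, (∀ x, ‖g x‖ ≤ B) → B < δ₀ →
        Continuous (Φ g (-(c ^ 2)⁻¹)) ∧ Tendsto (Φ g (-(c ^ 2)⁻¹)) (cocompact ℝ³) (𝓝 0) ∧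
          IsWeaklyDivFree (Φ g (-(c ^ 2)⁻¹)) ∧ ∀ x, ‖Φ g (-(c ^ 2)⁻¹) x‖ ≤ Λ * B := by
    intro g hg hg0 hgd B hB hBδ
    obtain ⟨-, hcont, hslice, -⟩ := hsol g hg hg0 hgd B hB hBδ
    obtain ⟨h0, hd, hb⟩ := hslice _ hmemI
    exact ⟨hcont.comp_continuous (continuous_const.prodMk continuous_id)
      fun x => ⟨hmemI, mem_univ x⟩, h0, hd, hb⟩
  obtain ⟨P, hPin, -, hP0, hPder⟩ := exists_selfMap_hasStrictFDerivAt_zero F hF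
    (fun g => Φ g (-(c ^ 2)⁻¹)) Klin hδ₀ hτ (fun x => hΦ0 _ x) hsol1 hder H KE hH hKE
  -- the period map and its derivative
  let T : F → F := fun g => Z (P g)
  let S : F →L[ℝ] F := Z.comp H
  let K : F →L[ℝ] F := Z.comp KE
  have hT0 : T 0 = 0 := by simp [T, hP0]
  have hTder : HasStrictFDerivAt T (S + K) 0 := by
    have h1 : HasStrictFDerivAt (fun g => Z (P g)) (Z.comp (H + KE)) 0 :=
      Z.hasStrictFDerivAt.comp 0 hPder
    rwa [ContinuousLinearMap.comp_add] at h1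
  have hKc : IsCompactOperator K := hKEc.clm_comp Z
  have hSn : ∀ n : ℕ, ‖S ^ n‖ ≤ 1 * c⁻¹ ^ n := by
    refine norm_pow_le_one_mul_pow S ?_
    calc ‖Z.comp H‖ ≤ ‖Z‖ * ‖H‖ := Z.opNorm_comp_le H
      _ ≤ c⁻¹ * 1 :=
          mul_le_mul hZn hHn (ContinuousLinearMap.opNorm_nonneg H) (inv_nonneg.2 hc0.le)
      _ = c⁻¹ := mul_one _
  -- dense directions and truncation data
  obtain ⟨D, hDdense, hDmem⟩ := exists_dense_submodule_testFields hE3 F hF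
  have hdecU : ∀ y : ℝ³, ‖y‖ * ‖u (-1) y‖ ≤ C₀ := by
    intro y
    have h1 := hdec (-1) (by norm_num) y
    rw [neg_neg, Real.sqrt_one] at h1
    have hC₀ : 0 ≤ C₀ := by
      have h0 := hdec (-1) (by norm_num) 0
      rw [neg_neg, Real.sqrt_one, norm_zero, zero_add, div_one] at h0
      exact (norm_nonneg _).trans h0
    have hpos : 0 < ‖y‖ + 1 := by positivity
    calc ‖y‖ * ‖u (-1) y‖ ≤ ‖y‖ * (C₀ / (‖y‖ + 1)) := by gcongr
      _ = C₀ * (‖y‖ / (‖y‖ + 1)) := by ring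
      _ ≤ C₀ * 1 := by
          gcongr
          rw [div_le_one hpos]; linarith
      _ = C₀ := mul_one _
  -- the orbit radius
  set η₀ : ℝ := min (δ₀ / 2) (‖u (-1) y₀‖ / 2) with hη₀
  have hUy₀ : 0 < ‖u (-1) y₀‖ := norm_pos_iff.2 hy₀
  have hη₀pos : 0 < η₀ := lt_min (half_pos hδ₀) (half_pos hUy₀)
  refine ⟨F, inferInstance, inferInstance, inferInstance, ι, D, T, S + K, S, K, hDdense,
    fun d hd => hDmem d hd, rfl, hKc, ⟨1, c⁻¹, inv_nonneg.2 hc0.le, inv_lt_one_of_one_lt₀ hc, hSn⟩,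
    hT0, hTder, fun ε hε => ?_, η₀, hη₀pos, fun g hg => ?_⟩
  · -- truncation data
    obtain ⟨e, he, hs, hcs, hdiv⟩ := exists_small_solenoidal_truncation_datum hE3 F hF
      (hK.contDiff_slice (by norm_num)) (hK.isDivFree (by norm_num)) hdecU hε
    exact ⟨e, he, hs, hcs, hdiv⟩
  · -- semantics of a trapped orbit
    have hgk : ∀ k, ‖T^[k] g‖ < δ₀ := fun k =>
      (hg k).trans_le ((min_le_left _ _).trans (half_le_self hδ₀.le))
    have hsolk : ∀ k, Φ (⇑(T^[k] g).1) (-1) = ⇑(T^[k] g).1 ∧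
        ContinuousOn (uncurry (Φ ⇑(T^[k] g).1)) (Icc (-1) (-(c ^ 2)⁻¹) ×ˢ univ) ∧
        (∀ t ∈ Icc (-1 : ℝ) (-(c ^ 2)⁻¹), Tendsto (Φ (⇑(T^[k] g).1) t) (cocompact ℝ³) (𝓝 0) ∧
          IsWeaklyDivFree (Φ (⇑(T^[k] g).1) t) ∧ ∀ x, ‖Φ (⇑(T^[k] g).1) t x‖ ≤ Λ * ‖T^[k] g‖) ∧
        (∀ s t : ℝ, -1 ≤ s → s < t → t ≤ -(c ^ 2)⁻¹ → ∀ x,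
          (u + Φ ⇑(T^[k] g).1) t x = heatFlow ((u + Φ ⇑(T^[k] g).1) s) (t - s) x -
            oseenDuhamel 1 s (u + Φ ⇑(T^[k] g).1) (u + Φ ⇑(T^[k] g).1) t x) := fun k =>
      hsol _ (hPf _).1 (hPf _).2.1 (hPf _).2.2 _ (hbd _) (hgk k)
    have hIcc : ∀ t ∈ Icc (-1 : ℝ) (-(c ^ 2)⁻¹), t < 0 := fun t ht => lt_of_le_of_lt ht.2 hqneg
    have hu_cont : ContinuousOn (uncurry u) (Icc (-1) (-(c ^ 2)⁻¹) ×ˢ univ) :=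
      hK.continuousOn_uncurry.mono (prod_mono (fun t ht => hIcc t ht) subset_rfl)
    -- bounds on the model slab
    have hbd' : ∀ k, ∃ M : ℝ, ∀ t ∈ Icc (-1 : ℝ) (-(c ^ 2)⁻¹), ∀ x,
        ‖(u + Φ ⇑(T^[k] g).1) t x‖ ≤ M := by
      intro k
      refine ⟨C / Real.sqrt ((c ^ 2)⁻¹) + Λ * ‖T^[k] g‖, fun t ht x => ?_⟩
      have ht0 : t < 0 := hIcc t ht
      have h1 : ‖u t x‖ ≤ C / Real.sqrt ((c ^ 2)⁻¹) := by
        refine (hK.norm_le ht0 x).trans ?_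
        exact div_le_div_of_nonneg_left hCnn (Real.sqrt_pos.2 hq0)
          (Real.sqrt_le_sqrt (by linarith [ht.2]))
      have h2 : ‖Φ (⇑(T^[k] g).1) t x‖ ≤ Λ * ‖T^[k] g‖ := ((hsolk k).2.2.1 t ht).2.2 x
      calc ‖(u + Φ ⇑(T^[k] g).1) t x‖ = ‖u t x + Φ (⇑(T^[k] g).1) t x‖ := rfl
        _ ≤ ‖u t x‖ + ‖Φ (⇑(T^[k] g).1) t x‖ := norm_add_le _ _
        _ ≤ _ := add_le_add h1 h2
    -- weakly divergence-free slices
    have hdiv' : ∀ k, ∀ t ∈ Icc (-1 : ℝ) (-(c ^ 2)⁻¹), IsWeaklyDivFree ((u + Φ ⇑(T^[k] g).1) t) := by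
      intro k t ht
      have ht0 : t < 0 := hIcc t ht
      have hΦc : Continuous (Φ (⇑(T^[k] g).1) t) :=
        (hsolk k).2.1.comp_continuous (continuous_const.prodMk continuous_id)
          fun x => ⟨ht, mem_univ x⟩
      exact (hK.isWeaklyDivFree ht0).add_of_continuous ((hsolk k).2.2.1 t ht).2.1
        (hK.continuous_slice ht0) hΦc
    -- the junction condition: `(u + Φ g_{k+1})(-1) = 𝒮⁻¹((u + Φ g_k)(-c⁻²))`
    have hjump' : ∀ k y, (u + Φ ⇑(T^[k + 1] g).1) (-1) y =
        c⁻¹ • R ((u + Φ ⇑(T^[k] g).1) (-(c ^ 2)⁻¹) (c⁻¹ • R.symm y)) := by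
      intro k y
      have hk1 := (hsolk (k + 1)).1
      have hiter : T^[k + 1] g = T (T^[k] g) := Function.iterate_succ_apply' T k g
      have hTval : (⇑(T (T^[k] g)).1 : ℝ³ → ℝ³) y =
          c⁻¹ • R (Φ (⇑(T^[k] g).1) (-(c ^ 2)⁻¹) (c⁻¹ • R.symm y)) := by
        show (Z (P (T^[k] g))).1 y = _
        rw [hZ, hPin _ (hgk k)]
      calc (u + Φ ⇑(T^[k + 1] g).1) (-1) y = u (-1) y + Φ (⇑(T^[k + 1] g).1) (-1) y := rfl
        _ = u (-1) y + (⇑(T^[k + 1] g).1 : ℝ³ → ℝ³) y := by rw [hk1]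
        _ = c⁻¹ • R (u (-(c ^ 2)⁻¹) (c⁻¹ • R.symm y)) +
              c⁻¹ • R (Φ (⇑(T^[k] g).1) (-(c ^ 2)⁻¹) (c⁻¹ • R.symm y)) := by
            rw [rdss_slice_neg_one hc0 hrdss y, hiter, hTval]
        _ = c⁻¹ • R ((u + Φ ⇑(T^[k] g).1) (-(c ^ 2)⁻¹) (c⁻¹ • R.symm y)) := by
            rw [← smul_add, ← map_add]
            rfl
    -- the orbit stays away from `-u(-1, y₀)`
    have hmk' : ∀ k, ‖u (-1) y₀‖ / 2 ≤ ‖(u + Φ ⇑(T^[k] g).1) (-1) y₀‖ := by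
      intro k
      have hk1 := (hsolk k).1
      have hgy : ‖(⇑(T^[k] g).1 : ℝ³ → ℝ³) y₀‖ ≤ ‖u (-1) y₀‖ / 2 :=
        ((hbd _ y₀).trans (hg k).le).trans (min_le_right _ _)
      have e : (u + Φ ⇑(T^[k] g).1) (-1) y₀ = u (-1) y₀ + (⇑(T^[k] g).1 : ℝ³ → ℝ³) y₀ := by
        show u (-1) y₀ + Φ (⇑(T^[k] g).1) (-1) y₀ = _
        rw [hk1]
      rw [e]
      have h := norm_sub_le (u (-1) y₀ + (⇑(T^[k] g).1 : ℝ³ → ℝ³) y₀) ((⇑(T^[k] g).1 : ℝ³ → ℝ³) y₀)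
      rw [add_sub_cancel_right] at h
      linarith
    obtain ⟨v, hv0, hvc, hvd, hvo, hvb, hvu⟩ := exists_concatenation_of_periodic_slabs hc R
      (fun k => u + Φ ⇑(T^[k] g).1) (fun k => hu_cont.add (hsolk k).2.1) hbd' hdiv'
      (fun k => (hsolk k).2.2.2) hjump' y₀ (half_pos hUy₀) hmk'
    refine ⟨v, ?_, hvc, hvd, hvo, hvb, hvu⟩
    rw [hv0]
    funext x
    have h0 := (hsolk 0).1
    simp only [Function.iterate_zero, id_eq] at h0
    simp only [Function.iterate_zero, id_eq, Pi.add_apply, h0]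
    rfl

end Summit.NavierStokesRegularity.NavierStokesRegularity.Theorems

end
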